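/-
Copyright (c) 2026 the pub-hodgecm-mathlib formalisation cell (harness21).  Prover seat hodgecm-mathlib-LH4-p08 (g5), Track A «(D-RAM) FOUR-FRAME», unit U2H, the census leaf
(ρ2b′-X) `stub_U2H_fixedPointCensus_typeTwo_unit0` — payer LH4-p14 (g4) 05:57:21Z brick (b) «the T5s WELD on type U»: the ★ T5s identity with the ★ T5a counts substituted.  2026-09-04.
-/
import Summits.HodgeConjecture.HodgeConjecture.Theorems.F0P3cDyRamToricLevelCensusUnrTop        -- ★ p857538 (R1-TOP, HYPER); brings TopPrep (Unr, UnrDep) and UnrAniso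
import Summits.HodgeConjecture.HodgeConjecture.Theorems.F0P3cDyRamToricLevelCensusUnrTopAniso   -- ★ p857647 (R1-TOP, ANISO)
import Summits.HodgeConjecture.HodgeConjecture.Theorems.F0P3cDyRamToricLevelCensusUnrTopSide    -- ★ p857722 (R1-TOP-SIDE) `topBit_hyper_iff'` ∕ `topBit_aniso_iff`
import Summits.HodgeConjecture.HodgeConjecture.Theorems.F0P3cDyRamToricCensusSumUnrV5           -- ★ p857461 T5s `toricCensusSum_unr_v5` (LH4-p04 (g3))
import HarnessLib

/-!
# T5a × T5s, type U: THE WELD — `ε·Σ_{j ≤ jλ} Σ_a q^a (#levelSetDep_h(j,a;μ) − #levelSetDep_{h′}(j,a;μ)) = q^m·(N_V − 2[S]_q)`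

★ T5s `toricCensusSum_unr_v5` (LH4-p04 (g3)) is the census-sum identity over ABSTRACT tables `nP nM vP vM : ℕ → ℕ → ℚ` constrained by eight hypotheses (`hnP hnP0 hnM hv0 hvOff
hvLow hvTopP hvTopM`).  THIS FILE substitutes the ★ T5a counts of this lineage — `nP j a := #levelSet_h(j,a)` (h HYPERBOLIC, ★ `ncard_levelSet_unr_hyper` p857436),
`nM := #levelSet_{h′}` (h′ ANISOTROPIC, ★ `ncard_levelSet_unr_aniso` p857464), `vP∕vM j a := #levelSetDep(j,a; λ − u)` for `j ≤ jλ` (★ p857473 (R1-A0∕OFF∕DIAG-LOW), ★ p857538 ∕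
p857647 (R1-TOP) with the bit closed by ★ p857722 `topBit_hyper_iff'` ∕ `topBit_aniso_iff`) — and discharges all eight, leaving ONE theorem in the heads' frame letters whose
left side is the census difference in `#levelSetDep` currency and whose right side is T5s's closed form: the consumer ((C0-final), payer LH4-p14) supplies the frame, the third-field
package (S2′), the two scalars `h` (hyperbolic line model) ∕ `h′` (anisotropic line model), the token data `(λ, u, m, jλ)` and the token-side facts (`jλ` even, realizability, `S − 1 ≤ m`).
HONEST LABEL: HC_CM is proved only modulo the 7 printed citations (2 remaining named inputs: hLiu418 = stmt-HodgeConjecture-24832,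
h413 = stmt-HodgeConjecture-24833) until rung 0 closes; (ρ2b′-X) :418 is an OPEN prover target — this file is a helper (`--supports`), proofs only.
-/

set_option autoImplicit false

open WithZero IsLocalRing Finset
open scoped Valued

namespace Summit.HodgeConjecture.HodgeConjecture.Cruxes.H413.F0P3cDyRamToricLevelCensusUnr

open Summit.HodgeConjecture.HodgeConjecture.Cruxes.H413.F0P3cDyRamToricCensusDefs
open Summit.HodgeConjecture.HodgeConjecture.Cruxes.H413.F0P3cDyRamToricCensusSumUnrV5 (toricCensusSum_unr_v5)

variable {K : Type*} [Field K] [Valued K ℤᵐ⁰] {ρ Θ : K →+* K} {α ϖE : K} {d t q : ℕ}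
variable {K' : Type*} [Field K'] [Valued K' ℤᵐ⁰] {σ' : K' →+* K'} {π' : K'}

/-- **THE T5s WELD ON TYPE U.**  In the ★ T5a heads' frame (M∕E unramified, third field `K'` with datum `(σ′, π′, d)` embedded by `jK`, unit-norm surjectivity, `#𝓀_M = q²`,
`#𝓀_{K′} = q`, `|2| = |ϖE|^t`, `K′` complete), for a HYPERBOLIC scalar `h`, an ANISOTROPIC scalar `h′`, the token `μ = λ − u` (`λΘλ = 1`, `ρu = u`, `uΘu = 1`, `|μ| = exp(−m)`,
`|μ − ρμ| = exp(−jλ)`) and the token-side facts of ★ T5s (`2 ≤ q`, `2 ≤ d`, `jλ` even, `S − 1 ≤ m`, realizability of `(ε, m)`):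
`ε·Σ_{j < jλ+1} Σ_{a < jλ+2} q^a·(#levelSetDep_h(j,a;μ) − #levelSetDep_{h′}(j,a;μ)) = q^m·((1 + (q+1)·Σ_{i < jλ∕2} q^i) − 2·Σ_{i < d − d%2} q^i)`.
[cite: Kottwitz1986BaseChangeUnits, §1 pp. 240–241] [cite: Rogawski1990, §4.9 Prop. 4.9.1 (b) p. 55, Lemma 4.9.3 p. 56] [cite: Flicker1998UnitaryFL, p. 84] -/
theorem toricCensusSum_unr_weld [IsDiscreteValuationRing 𝒪[K]] [Finite 𝓀[K]] [IsDiscreteValuationRing 𝒪[K']] [Finite 𝓀[K']] [IsAdicComplete 𝓂[K'] 𝒪[K']]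
    (hρρ : ∀ x, ρ (ρ x) = x) (hvρ : ∀ x, Valued.v (ρ x) = Valued.v x) (hΘΘ : ∀ x, Θ (Θ x) = x) (hΘρ : ∀ x, Θ (ρ x) = ρ (Θ x))
    (hvΘ : ∀ x, Valued.v (Θ x) = Valued.v x) (hα1 : Valued.v α ≤ 1) (hα : Valued.v (α - ρ α) = 1)
    (hρϖE : ρ ϖE = ϖE) (hϖE : Valued.v ϖE = exp (-1 : ℤ)) (hq : Nat.card 𝓀[K] = q ^ 2) (h2 : Valued.v (2 : K) = Valued.v ϖE ^ t)
    (hσ' : ∀ x, σ' (σ' x) = x) (hvσ' : ∀ x, Valued.v (σ' x) = Valued.v x) (hfix' : ∀ x : K', σ' x = x → x ≠ 0 → ∃ n : ℤ, Valued.v x = exp (2 * n))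
    (hπ' : Valued.v π' = exp (-1 : ℤ)) (hdd' : Valued.v (π' - σ' π') = Valued.v π' ^ d) (hd : 1 ≤ d) (hq' : Nat.card 𝓀[K'] = q)
    (jK : K' →+* K) (hjv : ∀ x, Valued.v (jK x) = Valued.v x) (hjΘ : ∀ x, Θ (jK x) = jK x)
    (hjfix : ∀ z : K, Θ z = z → ∃ x, jK x = z) (hjσ : ∀ x, jK (σ' x) = ρ (jK x))
    (hnorm : ∀ z : Kˣ, Θ (z : K) = z → Valued.v (z : K) = 1 → ∃ ω : Kˣ, Valued.v (ω : K) = 1 ∧ (ω : K) * Θ ω = z)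
    {h h' : K} (hΘh : Θ h = h) (hh : h ≠ 0) (hhyper : ∃ x : K, x ≠ 0 ∧ h * Θ x * x + ρ (h * Θ x * x) = 0)
    (hΘh' : Θ h' = h') (hh' : h' ≠ 0) (haniso : ¬ ∃ x : K, x ≠ 0 ∧ h' * Θ x * x + ρ (h' * Θ x * x) = 0)
    {lam u : K} (hlam : lam * Θ lam = 1) (hu : ρ u = u) (hu1 : u * Θ u = 1)
    {m jl : ℕ} (hm : Valued.v (lam - u) = exp (-(m : ℤ))) (hjl : Valued.v ((lam - u) - ρ (lam - u)) = exp (-(jl : ℤ)))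
    (hq2 : 2 ≤ q) (hd2 : 2 ≤ d) (hjl2 : jl % 2 = 0) (hmS : d - d % 2 ≤ m + 1) (ε : ℚ)
    (hreal : (ε = 1 ∧ m % 2 = d % 2 ∧ 1 ≤ m ∧ m + d ≤ jl) ∨ (ε = -1 ∧ m = jl - d + 1 ∧ d ≤ jl)) :
    ε * ∑ j ∈ range (jl + 1), ∑ a ∈ range (jl + 2), (q : ℚ) ^ a *
        (((levelSetDep ρ Θ α ϖE h j a (lam - u)).ncard : ℚ) - ((levelSetDep ρ Θ α ϖE h' j a (lam - u)).ncard : ℚ)) =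
      (q : ℚ) ^ m * ((1 + ((q : ℚ) + 1) * ∑ i ∈ range (jl / 2), (q : ℚ) ^ i) - 2 * ∑ i ∈ range (d - d % 2), (q : ℚ) ^ i) := by
  classical
  -- token bookkeeping: `m ≤ jλ`
  have hmjl : m ≤ jl := by
    have hle : Valued.v ((lam - u) - ρ (lam - u)) ≤ Valued.v (lam - u) :=
      (Valuation.map_sub _ _ _).trans (max_le le_rfl (by rw [hvρ]))
    rw [hjl, hm, exp_le_exp] at hle; omega
  have hq1 : 1 ≤ q := by omega
  have hqQ0 : (q : ℚ) ≠ 0 := Nat.cast_ne_zero.2 (by omega)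
  have hqQ1 : (q : ℚ) - 1 ≠ 0 := sub_ne_zero.2 (by exact_mod_cast (show q ≠ 1 by omega))
  have hcast1 : (((q - 1 : ℕ) : ℚ)) = (q : ℚ) - 1 := by rw [Nat.cast_sub hq1, Nat.cast_one]
  have hcast2 : (((q ^ 2 - 1 : ℕ) : ℚ)) = (q : ℚ) ^ 2 - 1 := by rw [Nat.cast_sub (Nat.one_le_pow _ _ (by omega)), Nat.cast_pow, Nat.cast_one]
  -- the ★ heads, abbreviated
  have HP : ∀ j a, (levelSet ρ Θ α ϖE h j a).ncard =
      if 1 ≤ a ∧ a + d ≤ j ∧ (j - a - d) % 2 = 0 then (q ^ 2 - 1) * q ^ (j - 2 - (j - a - d) / 2)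
      else if a = 0 ∧ (j + d) % 2 = 0 then (if d ≤ j then (q + 1) * q ^ ((j + d) / 2 - 1) else (if j = 0 then 1 else (q + 1) * q ^ (j - 1)))
      else 0 := fun j a =>
    ncard_levelSet_unr_hyper hρρ hvρ hΘΘ hΘρ hvΘ hα1 hα hρϖE hϖE hΘh hh hq hσ' hvσ' hfix' hπ' hdd' hd hq' jK hjv hjΘ hjfix hjσ hnorm hhyper j a
  have HM : ∀ j a, (levelSet ρ Θ α ϖE h' j a).ncard =
      if (d ≤ j + 1 ∧ a + d = j + 1) ∨ (j + 1 < d ∧ a = 0 ∧ (j + d) % 2 = 1) then (if j = 0 then 1 else (q + 1) * q ^ (j - 1)) else 0 := fun j a =>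
    ncard_levelSet_unr_aniso hρρ hvρ hΘΘ hΘρ hvΘ hα1 hα hρϖE hϖE hΘh' hh' hq hσ' hvσ' hfix' hπ' hdd' hd jK hjv hjΘ hjfix hjσ hnorm haniso j a
  -- the tables
  obtain ⟨nP, hnPdef⟩ : ∃ f : ℕ → ℕ → ℚ, f = fun j a => ((levelSet ρ Θ α ϖE h j a).ncard : ℚ) := ⟨_, rfl⟩
  obtain ⟨nM, hnMdef⟩ : ∃ f : ℕ → ℕ → ℚ, f = fun j a => ((levelSet ρ Θ α ϖE h' j a).ncard : ℚ) := ⟨_, rfl⟩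
  obtain ⟨vP, hvPdef⟩ : ∃ f : ℕ → ℕ → ℚ, f = fun j a =>
      if j ≤ jl then ((levelSetDep ρ Θ α ϖE h j a (lam - u)).ncard : ℚ) else (if a = 0 then nP j 0 else 0) := ⟨_, rfl⟩
  obtain ⟨vM, hvMdef⟩ : ∃ f : ℕ → ℕ → ℚ, f = fun j a =>
      if j ≤ jl then ((levelSetDep ρ Θ α ϖE h' j a (lam - u)).ncard : ℚ) else (if a = 0 then nM j 0 else 0) := ⟨_, rfl⟩
  -- (1) `hnP`
  have hnP : ∀ j a, 1 ≤ a → nP j a = if a + d ≤ j ∧ (j - a - d) % 2 = 0 then ((q : ℚ) ^ 2 - 1) * (q : ℚ) ^ (j - 2 - (j - a - d) / 2) else 0 := by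
    intro j a ha
    rw [hnPdef]; dsimp only; rw [HP j a]
    by_cases hc : a + d ≤ j ∧ (j - a - d) % 2 = 0
    · rw [if_pos ⟨ha, hc⟩, if_pos hc, Nat.cast_mul, hcast2, Nat.cast_pow]
    · rw [if_neg (fun h3 => hc h3.2), if_neg (by omega), if_neg hc, Nat.cast_zero]
  -- (2) `hnP0`
  have hnP0 : ∀ j, nP j 0 = if (j + d) % 2 = 0 then
      (if d ≤ j then ((q : ℚ) + 1) * (q : ℚ) ^ ((j + d) / 2 - 1) else (if j = 0 then 1 else ((q : ℚ) + 1) * (q : ℚ) ^ (j - 1))) else 0 := by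
    intro j
    rw [hnPdef]; dsimp only; rw [HP j 0, if_neg (by omega)]
    by_cases hpar : (j + d) % 2 = 0
    · rw [if_pos ⟨rfl, hpar⟩, if_pos hpar]; push_cast; rfl
    · rw [if_neg (fun h3 => hpar h3.2), if_neg hpar, Nat.cast_zero]
  -- (3) `hnM`
  have hnM : ∀ j a, nM j a = if (d ≤ j + 1 ∧ a + d = j + 1) ∨ (j + 1 < d ∧ a = 0 ∧ (j + d) % 2 = 1) then
      (if j = 0 then 1 else ((q : ℚ) + 1) * (q : ℚ) ^ (j - 1)) else 0 := by
    intro j a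
    rw [hnMdef]; dsimp only; rw [HM j a]; push_cast; rfl
  -- (4) `hv0`
  have hv0 : ∀ j, vP j 0 = nP j 0 ∧ vM j 0 = nM j 0 := by
    intro j
    by_cases hj : j ≤ jl
    · rw [hvPdef, hvMdef, hnPdef, hnMdef]; dsimp only; rw [if_pos hj, if_pos hj,
        ncard_levelSetDep_zero hρρ hvρ hΘΘ hΘρ hvΘ hα1 hα hρϖE hϖE hh hm hjl hj,
        ncard_levelSetDep_zero hρρ hvρ hΘΘ hΘρ hvΘ hα1 hα hρϖE hϖE hh' hm hjl hj]
      exact ⟨rfl, rfl⟩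
    · rw [hvPdef, hvMdef]; dsimp only; rw [if_neg hj, if_neg hj, if_pos rfl, if_pos rfl]
      exact ⟨rfl, rfl⟩
  -- (5) `hvOff`
  have hvOff : ∀ j a, 1 ≤ a → j + m ≠ jl + a →
      (vP j a = if 2 * a ≤ m ∧ (j + a ≤ m ∨ j + a ≤ jl) then nP j a else 0) ∧
        (vM j a = if 2 * a ≤ m ∧ (j + a ≤ m ∨ j + a ≤ jl) then nM j a else 0) := by
    intro j a ha hoff
    by_cases hj : j ≤ jl
    · rw [hvPdef, hvMdef, hnPdef, hnMdef]; dsimp only; rw [if_pos hj, if_pos hj,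
        ncard_levelSetDep_offDiag hρρ hvρ hΘΘ hΘρ hvΘ hα1 hα hρϖE hϖE hh hm hjl ha hoff,
        ncard_levelSetDep_offDiag hρρ hvρ hΘΘ hΘρ hvΘ hα1 hα hρϖE hϖE hh' hm hjl ha hoff]
      constructor <;> (split_ifs <;> simp)
    · rw [hvPdef, hvMdef]; dsimp only
      have h1 : ¬ (2 * a ≤ m ∧ (j + a ≤ m ∨ j + a ≤ jl)) := by omega
      have h2 : ¬ a = 0 := by omega
      rw [if_neg hj, if_neg hj, if_neg h2, if_neg h2, if_neg h1, if_neg h1]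
      exact ⟨rfl, rfl⟩
  -- (6) `hvLow`
  have hvLow : ∀ j a, 1 ≤ a → j + m = jl + a → 2 * a ≤ m → vP j a = nP j a ∧ vM j a = nM j a := by
    intro j a ha hdiag hlow
    have hj : j ≤ jl := by omega
    rw [hvPdef, hvMdef, hnPdef, hnMdef]; dsimp only; rw [if_pos hj, if_pos hj,
      ncard_levelSetDep_diag_low hρρ hvρ hΘΘ hΘρ hvΘ hα1 hα hρϖE hϖE hh hm hjl ha hdiag hlow,
      ncard_levelSetDep_diag_low hρρ hvρ hΘΘ hΘρ hvΘ hα1 hα hρϖE hϖE hh' hm hjl ha hdiag hlow]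
    exact ⟨rfl, rfl⟩
  -- (7) `hvTopP`
  have hvTopP : ∀ j a, 1 ≤ a → j + m = jl + a → m < 2 * a →
      vP j a = if (d + m ≤ jl ∧ (jl - d - m) % 2 = 0) ∧ 2 * j + d ≤ 2 * jl + 1
        then nP j a / (((q : ℚ) - 1) * (q : ℚ) ^ ((2 * a - m + 1) / 2 - 1)) else 0 := by
    intro j a ha hdiag htop
    by_cases hj : j ≤ jl
    · have H := ncard_levelSetDep_top_hyper hρρ hvρ hΘΘ hΘρ hvΘ hα1 hα hρϖE hϖE hΘh hh hq hσ' hvσ' hfix' hπ' hdd' hd hq' jK hjv hjΘ hjfix hjσ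
        hnorm hhyper hm hjl hj ha hdiag (by omega)
      have B := topBit_hyper_iff' hρρ hvρ hΘΘ hΘρ hvΘ hα1 hα hρϖE hϖE h2 hΘh hh hσ' hvσ' hfix' hπ' hdd' hd jK hjv hjΘ hjfix hjσ hnorm hhyper
        hlam hu hu1 hm hjl hj ha hdiag (by omega)
      have hφ : ((q : ℚ) - 1) * (q : ℚ) ^ ((2 * a - m + 1) / 2 - 1) ≠ 0 := mul_ne_zero hqQ1 (pow_ne_zero _ hqQ0)
      rw [hvPdef, hnPdef]; dsimp only; rw [if_pos hj]
      by_cases hc : (d + m ≤ jl ∧ (jl - d - m) % 2 = 0) ∧ 2 * j + d ≤ 2 * jl + 1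
      · rw [if_pos (B.2 hc)] at H
        rw [if_pos hc, eq_div_iff hφ]
        have := congrArg (Nat.cast : ℕ → ℚ) H
        rw [Nat.cast_mul, Nat.cast_mul, hcast1, Nat.cast_pow] at this
        linear_combination this
      · rw [if_neg (fun h1 => hc (B.1 h1))] at H
        rw [if_neg hc]
        have hφN : (q - 1) * q ^ ((2 * a - m + 1) / 2 - 1) ≠ 0 := mul_ne_zero (by omega) (pow_ne_zero _ (by omega))
        rw [(mul_eq_zero.1 H).resolve_left hφN, Nat.cast_zero]
    · rw [hvPdef]; dsimp only; rw [if_neg hj, if_neg (by omega), if_neg (by omega)]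
  -- (8) `hvTopM`
  have hvTopM : ∀ j a, 1 ≤ a → j + m = jl + a → m < 2 * a →
      vM j a = if jl + 1 = d + m ∧ 2 * j + d ≤ 2 * jl + 1 then nM j a / (q : ℚ) ^ ((2 * a - m) / 2) else 0 := by
    intro j a ha hdiag htop
    by_cases hj : j ≤ jl
    · have H := ncard_levelSetDep_top_aniso hρρ hvρ hΘΘ hΘρ hvΘ hα1 hα hρϖE hϖE hΘh' hh' hq hσ' hvσ' hfix' hπ' hdd' hd hq' jK hjv hjΘ hjfix hjσ
        hnorm haniso hm hjl hj ha hdiag (by omega)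
      have B := topBit_aniso_iff hρρ hvρ hΘΘ hΘρ hvΘ hα1 hα hρϖE hϖE h2 hΘh' hh' hσ' hvσ' hfix' hπ' hdd' hd jK hjv hjΘ hjfix hjσ hnorm haniso
        hlam hu hu1 hm hjl hj ha hdiag (by omega)
      have hφ : (q : ℚ) ^ ((2 * a - m) / 2) ≠ 0 := pow_ne_zero _ hqQ0
      rw [hvMdef, hnMdef]; dsimp only; rw [if_pos hj]
      by_cases hc : jl + 1 = d + m ∧ 2 * j + d ≤ 2 * jl + 1
      · rw [if_pos (B.2 hc)] at H
        rw [if_pos hc, eq_div_iff hφ]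
        have := congrArg (Nat.cast : ℕ → ℚ) H
        rw [Nat.cast_mul, Nat.cast_pow] at this
        linear_combination this
      · rw [if_neg (fun h1 => hc (B.1 h1))] at H
        rw [if_neg hc]
        rw [(mul_eq_zero.1 H).resolve_left (pow_ne_zero _ (by omega)), Nat.cast_zero]
    · rw [hvMdef]; dsimp only; rw [if_neg hj, if_neg (by omega), if_neg (by omega)]
  -- the ★ T5s identity, then unfold the tables on `j ≤ jλ`
  have key := toricCensusSum_unr_v5 q ε hq2 hd2 hjl2 hmS hreal nP nM vP vM hnP hnP0 hnM hv0 hvOff hvLow hvTopP hvTopM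
  rw [← key]
  congr 1
  refine sum_congr rfl fun j hj => sum_congr rfl fun a _ => ?_
  have hj' : j ≤ jl := by rw [mem_range] at hj; omega
  rw [hvPdef, hvMdef]; dsimp only; rw [if_pos hj', if_pos hj']

end Summit.HodgeConjecture.HodgeConjecture.Cruxes.H413.F0P3cDyRamToricLevelCensusUnr
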